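import Literature.NumberTheory.Automorphic.ArchTorusOrbitalFunctionAtPoint           -- ★ `OrbitalMeasureFamily.IsCanonical.classOrbitalIntegral_mk_eq_integral_conj_of_isCompact` (generic §1); brings ★ `integral_quotientMeasure_eq_inv_smul`
import Literature.NumberTheory.Automorphic.UnitaryThreeAnisotropicStabilizerCompact   -- ★ `UnitaryGroup.compactSpace_centralizer_of_continuousMulEquiv`
import Literature.NumberTheory.Automorphic.LocalUnitaryGroupCongrMeasure              -- ★ instances `locallyCompactSpace_cmDatum_local`, `secondCountableTopology_cmDatum_local`, `t2Space_cmDatum_local`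
import Literature.NumberTheory.Rogawski1990.AdelicClassOrbitalIntegralFiniteSupportG2 -- ★ `isRegularElt_of_isConj`
import Summits.HodgeConjecture.HodgeConjecture.Theorems.R90S6ConstantTermTransportValue -- ★ B2a FILE 2 `continuous_coeff_mk` (+ FILE 1's frame §, ★ `isOpen_unitaryInt`)
import HarnessLib

/-!
# R90 ∕ S6 (h413 = `stmt-HodgeConjecture-24833`), row E1.3.3.4 (elliptic half), (G3) «T-ELL»: THE CANONICAL CLASS ORBITAL INTEGRAL OF `coeff φ ∘ eG` AT AN
# ELLIPTIC CLASS OF `G′_v`, CARRIED THROUGH THE SOCKET FRAME `eG` TO THE TREE-COUNT CURRENCY OF ★ A1 ∕ ★ G3 ∕ ★ G3-NUMBERS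

Cell `hodgecm-mathlib`, Track B «K2-LIT», crux item h413 = `stmt-HodgeConjecture-24833` (route `HCCMUnconditional`, no route verbs); section S6 (base `R90-C14`,
Rogawski Ch. 14.1–14.5, the stable trace-formula floor), dealer R90-C14-plan (g2), deal (G3) «T-ELL» 02:58:02Z to seat K2E3-p34 (g3) (chair K2-lead VALVE 26 (ee));
statement layer = typist R90-C14-typ2 (g3)'s census + heads `R90/R90-C14-typ2/g3/S6_TELL_EllipticOrbitalTransport_Census.v1.md` (sha16 0ed59d6530b584c9) (T.1)–(T.10),
written here with the proofs the ★ bricks give.  Lane `--kind proof --supports stmt-HodgeConjecture-24833 --as helper`; THEOREMS ONLY (no definition, no instance, no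
notation, no named-fact hypothesis, no `sorry`); never imports `Lines/`.

THE POINT.  The socket `HeckeFLAtFrame` (D `Cruxes/H413/Lines/R90_S6_FloorE1D.lean` ED. 5 :901–:951) hands the G-side of the fundamental-lemma identity as the CANONICAL class
orbital integral `classOrbitalIntegral mG (fun g => heckeToFun K₀ φ (eG g)) c` on `G′_v := (cmDatum L 3 H′).Local v`, `mG` canonical for `(IsRegularElt, νG v)`, `eG : G′_v ≃ₜ* U′`
the frame to `U′ = U(σ_w, J₀)(L_w)`, `K₀ = U′ ∩ GL₃(𝒪_w)` with the K-law `eG g ∈ K₀ ↔ g ∈ cmLocalIntegralLevel`, and `heckeToFun K₀ φ u = (toVector K₀ φ).coeff (u K₀)` (a `Lines`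
`def`; this file spells the `coeff` form, the assembler closes the gap by `rfl`).  The payers ★ A1 `orbitalIntegral_doubleCosetShell_eq_mul_ncard_displaced`, ★ G3 and ★ G3-NUMBERS
speak `orbitalIntegral γ′ F (quotientMeasure Z({γ′}) t ν)` on `U′` for a mass-one `t` on a COMPACT centraliser.  This file is the transport between the two currencies at an ELLIPTIC
(compact-centraliser) class: §A the frame calculus (`∫ F(e(ygy⁻¹)) dν = ∫ F(u·eg·u⁻¹) d(e_*ν)`, right-invariance and the K-mass transported, compact centralisers transported);
§B canonical ⟶ plain ⟶ A1's quotient-measure currency through the frame (generic groups); §C the dock in the socket's letters at generic `N` (so the H-side twin at `N = 2`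
after U1B is the same theorem): **`classOrbitalIntegral_coeff_toVector_frame_eq_integral_conj`** (plain form, head for (G5)) and
**`classOrbitalIntegral_coeff_toVector_frame_eq_orbitalIntegral`** (A1's currency, head for (G1)∕(E1)), plus the K-mass `(νG.map eG) K₀ = 1`.
WHY `t′` IS HARMLESS: the left-hand sides never mention `t′`; the assembler picks ANY admissible mass-one `t′` on the compact `Z({eG g})`.
HONEST LABEL: HC_CM is proved only modulo the 7 printed citations (2 remaining named inputs: hLiu418 = stmt-HodgeConjecture-24832, h413 = stmt-HodgeConjecture-24833) until
rung 0 closes; count-neutral helper — this file pays no socket and closes nothing; h413 is NOT closable this cycle.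

## References
* [Rogawski1990] J. D. Rogawski, *Automorphic Representations of Unitary Groups in Three Variables*, Ann. of Math. Stud. 123 (1990), §4.3 (4.3.1) p. 43; §4.9 pp. 54–56.
* [DeitmarEchterhoff2014] A. Deitmar, S. Echterhoff, *Principles of Harmonic Analysis*, 2nd ed. (2014), Thm. 1.5.3, Cor. 1.5.4.
* [Folland1995] G. B. Folland, *A Course in Abstract Harmonic Analysis* (1995), §2.6 (2.52).
* [Kottwitz1986BaseChangeUnits] R. Kottwitz, *Base change for unit elements of Hecke algebras*, Compositio Math. 60 (1986), §1 pp. 240–242.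
-/

set_option autoImplicit false
-- the mandated namespace repeats the single-problem summit's segment (`HodgeConjecture.HodgeConjecture`)
set_option linter.dupNamespace false

noncomputable section

open MeasureTheory Measure Set Function NumberField IsDedekindDomain
open scoped ENNReal NNReal Pointwise Valued WithZero Matrix MatrixGroups
open Literature.MeasureTheory.Group
open Literature.NumberTheory.Automorphic Literature.NumberTheory.Automorphic.HermitianLattice Literature.NumberTheory.Automorphic.heckeAlgebra
  Literature.NumberTheory.Automorphic.UnitaryGroup
open Literature.NumberTheory.Rogawski1990 (IsRegularElt isRegularElt_of_isConj)

namespace Summit.HodgeConjecture.HodgeConjecture.R90.S6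

/-! ## §A Generic frame calculus along a topological group isomorphism `e : G ≃ₜ* G′` -/

section Frame

variable {G G' : Type*} [Group G] [Group G'] [TopologicalSpace G] [TopologicalSpace G'] [IsTopologicalGroup G] [IsTopologicalGroup G']
  [MeasurableSpace G] [BorelSpace G] [MeasurableSpace G'] [BorelSpace G'] (e : G ≃ₜ* G') (ν : Measure G)
  {E' : Type*} [NormedAddCommGroup E'] [NormedSpace ℝ E']

omit [IsTopologicalGroup G] [IsTopologicalGroup G'] in
/-- **(T.1) conjugation integrals through the frame**: `∫_G F(e(y g y⁻¹)) dν(y) = ∫_{G′} F(u · e g · u⁻¹) d(e_*ν)(u)` (change of variables along the measurable embedding `e`,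
`e(y g y⁻¹) = e y · e g · (e y)⁻¹`). [cite: DeitmarEchterhoff2014, Thm. 1.5.3] [cite: Rogawski1990, §4.3 (4.3.1) p. 43] -/
theorem integral_conj_comp_frame_eq_integral_map (F : G' → E') (g : G) :
    ∫ y, F (e (y * g * y⁻¹)) ∂ν = ∫ u, F (u * e g * u⁻¹) ∂(ν.map e) := by
  have hm : Measurable (⇑e : G → G') := e.continuous.measurable
  have hemb : MeasurableEmbedding (⇑e : G → G') := e.toHomeomorph.measurableEmbedding
  rw [← (hm.measurePreserving ν).integral_comp hemb (fun u => F (u * e g * u⁻¹))]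
  simp only [map_mul, map_inv]

/-- **(T.2) right-invariance is transported**: if `ν` is right-invariant then so is `e_*ν` (`(· * h) ∘ e = e ∘ (· * e⁻¹ h)`; Mathlib has the left twin `isMulLeftInvariant_map`).
[cite: DeitmarEchterhoff2014, Thm. 1.5.3] -/
theorem isMulRightInvariant_map_frame [ν.IsMulRightInvariant] : (ν.map e).IsMulRightInvariant := by
  refine ⟨fun h => ?_⟩
  have hm : Measurable (⇑e) := e.continuous.measurable
  have hcomp : ((· * h) ∘ (⇑e) : G → G') = (⇑e) ∘ (· * e.symm h) := by
    funext x
    simp only [Function.comp_apply, map_mul, ContinuousMulEquiv.apply_symm_apply]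
  calc Measure.map (· * h) (ν.map e) = Measure.map ((· * h) ∘ (⇑e)) ν := Measure.map_map (measurable_mul_const h) hm
    _ = Measure.map ((⇑e) ∘ (· * e.symm h)) ν := by rw [hcomp]
    _ = Measure.map e (Measure.map (· * e.symm h) ν) := (Measure.map_map hm (measurable_mul_const _)).symm
    _ = ν.map e := by rw [map_mul_right_eq_self]

omit [IsTopologicalGroup G] [IsTopologicalGroup G'] in
/-- **(T.3) the K-mass is transported**: under the K-law `e g ∈ K₀ ↔ g ∈ K` (and `K₀` measurable), `(e_*ν)(K₀) = ν(K)`. [cite: DeitmarEchterhoff2014, Thm. 1.5.3] -/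
theorem map_frame_apply_eq_of_memLaw {K : Subgroup G} {K₀ : Subgroup G'} (hEK : ∀ g : G, e g ∈ K₀ ↔ g ∈ K) (hK₀ : MeasurableSet (K₀ : Set G')) :
    (ν.map e) K₀ = ν K := by
  have hm : Measurable (⇑e : G → G') := e.continuous.measurable
  rw [Measure.map_apply hm hK₀]
  congr 1
  ext g
  simp only [Set.mem_preimage, SetLike.mem_coe, hEK]

omit [IsTopologicalGroup G] [IsTopologicalGroup G'] [MeasurableSpace G] [BorelSpace G] [MeasurableSpace G'] [BorelSpace G'] in
/-- **(T.4) compact centralisers are transported**: `Z({g})` compact ⇒ `Z({e g})` compact (★ `compactSpace_centralizer_of_continuousMulEquiv` for `e⁻¹` at `e g`).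
[cite: Rogawski1990, §4.3 (4.3.1) p. 43] [cite: DeitmarEchterhoff2014, Thm. 1.5.3] -/
theorem compactSpace_centralizer_frame (g : G) [CompactSpace ↥(Subgroup.centralizer ({g} : Set G))] :
    CompactSpace ↥(Subgroup.centralizer ({e g} : Set G')) := by
  haveI : CompactSpace ↥(Subgroup.centralizer ({e.symm (e g)} : Set G)) := by
    rw [ContinuousMulEquiv.symm_apply_apply]; infer_instance
  exact UnitaryGroup.compactSpace_centralizer_of_continuousMulEquiv e.symm (e g)

end Frame

/-! ## §B Canonical ⟶ plain ⟶ the quotient-measure currency, through the frame (generic groups) -/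

section Canonical

variable {G G' : Type*} [Group G] [Group G'] [TopologicalSpace G] [TopologicalSpace G'] [IsTopologicalGroup G] [IsTopologicalGroup G']
  [LocallyCompactSpace G] [SecondCountableTopology G] [T2Space G]
  [MeasurableSpace G] [BorelSpace G] [MeasurableSpace G'] [BorelSpace G']
  [∀ γ : G, MeasurableSpace (G ⧸ Subgroup.centralizer ({γ} : Set G))] [∀ γ : G, BorelSpace (G ⧸ Subgroup.centralizer ({γ} : Set G))]
  (e : G ≃ₜ* G') {ν : Measure G} [ν.IsHaarMeasure] [ν.IsMulRightInvariant] {P : G → Prop} {m : OrbitalMeasureFamily G} (hm : m.IsCanonical P ν)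

omit [IsTopologicalGroup G'] in
include hm in
/-- **(T.5) THE CANONICAL CLASS ORBITAL INTEGRAL OF `F ∘ e` AT A COMPACT-CENTRALISER CLASS IS A PLAIN INTEGRAL ON THE TARGET OF THE FRAME**:
`classOrbitalIntegral m (F ∘ e) ⟦g⟧ = ∫_{G′} F(u · e g · u⁻¹) d(e_*ν)(u)` for `m` canonical for `(P, ν)`, `P (out ⟦g⟧)`, `Z({g})` compact, `F` continuous
(★ `IsCanonical.classOrbitalIntegral_mk_eq_integral_conj_of_isCompact` + (T.1)). [cite: Rogawski1990, §4.3 (4.3.1) p. 43; §4.9 p. 54] [cite: DeitmarEchterhoff2014, Cor. 1.5.4] -/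
theorem classOrbitalIntegral_comp_frame_eq_integral_conj_map (g : G) (hc : P (Quotient.out (ConjClasses.mk g)))
    [CompactSpace ↥(Subgroup.centralizer ({g} : Set G))] (F : G' → ℂ) (hF : Continuous F) :
    classOrbitalIntegral m (fun x => F (e x)) (ConjClasses.mk g) = ∫ u, F (u * e g * u⁻¹) ∂(ν.map e) := by
  have hFe : Continuous (fun x => F (e x)) := hF.comp e.continuous
  rw [hm.classOrbitalIntegral_mk_eq_integral_conj_of_isCompact g hc (isCompact_iff_compactSpace.2 inferInstance) (fun x => F (e x)) hFe]
  exact integral_conj_comp_frame_eq_integral_map e ν F g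

omit [IsTopologicalGroup G] [LocallyCompactSpace G] [SecondCountableTopology G] [T2Space G] [MeasurableSpace G] [BorelSpace G]
  [∀ γ : G, MeasurableSpace (G ⧸ Subgroup.centralizer ({γ} : Set G))] [∀ γ : G, BorelSpace (G ⧸ Subgroup.centralizer ({γ} : Set G))] in
/-- **(T.6) THE QUOTIENT-MEASURE ORBITAL INTEGRAL AT A COMPACT CENTRALISER OF MASS ONE IS THE PLAIN INTEGRAL** — in exactly ★ A1's instance letters on the centraliser measure
`t′` (left-invariant, finite on compacts, open-positive, inversion-invariant, s-finite; `t′(Z) = 1`): `orbitalIntegral γ′ F (ν′ ∕ t′) = ∫_{G′} F(u γ′ u⁻¹) dν′(u)`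
(★ `integral_quotientMeasure_eq_inv_smul`, Folland (2.52)). [cite: Folland1995, §2.6 (2.52)] [cite: Rogawski1990, §4.9 p. 54] -/
theorem orbitalIntegral_quotientMeasure_eq_integral_conj_of_measure_univ_eq_one
    [LocallyCompactSpace G'] [SecondCountableTopology G'] [T2Space G'] (γ' : G')
    [MeasurableSpace (G' ⧸ Subgroup.centralizer ({γ'} : Set G'))] [BorelSpace (G' ⧸ Subgroup.centralizer ({γ'} : Set G'))]
    [hC : IsClosed ((Subgroup.centralizer ({γ'} : Set G') : Subgroup G') : Set G')]
    (t' : Measure ↥(Subgroup.centralizer ({γ'} : Set G'))) [t'.IsMulLeftInvariant] [IsFiniteMeasureOnCompacts t'] [t'.IsOpenPosMeasure] [t'.IsInvInvariant] [SFinite t']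
    (ν' : Measure G') [ν'.IsHaarMeasure] [ν'.IsMulRightInvariant] [CompactSpace ↥(Subgroup.centralizer ({γ'} : Set G'))] (ht' : t' Set.univ = 1)
    {E' : Type*} [NormedAddCommGroup E'] [NormedSpace ℝ E'] (F : G' → E') (hF : Continuous F) :
    orbitalIntegral γ' F (quotientMeasure (Subgroup.centralizer ({γ'} : Set G')) t' hC ν') = ∫ u, F (u * γ' * u⁻¹) ∂ν' := by
  haveI : IsProbabilityMeasure t' := ⟨ht'⟩
  rw [orbitalIntegral_eq_integral_descConj,
    integral_quotientMeasure_eq_inv_smul _ t' ν' _ (continuous_descConj _ _ _ hF).stronglyMeasurable]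
  simp only [descConj_mk, probReal_univ, inv_one, one_smul]

include hm in
/-- **(T.7) THE JOIN — CANONICAL CLASS ORBITAL INTEGRAL OF `F ∘ e` = QUOTIENT-MEASURE ORBITAL INTEGRAL OF `F` AT `e g` AGAINST `e_*ν`**, for ANY admissible mass-one `t′` on the
compact `Z({e g})` ((T.5) ▸ (T.6) at `ν′ := e_*ν`, Haar by Mathlib's instance, `Z({e g})` compact by (T.4); the right-invariance of `e_*ν` is a BINDER because ★ `quotientMeasure`'s
signature wants it as an instance — the consumer says `haveI := isMulRightInvariant_map_frame e ν` ((T.2))).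
[cite: Rogawski1990, §4.3 (4.3.1) p. 43; §4.9 p. 54] [cite: DeitmarEchterhoff2014, Thm. 1.5.3, Cor. 1.5.4] -/
theorem classOrbitalIntegral_comp_frame_eq_orbitalIntegral_map (g : G) (hc : P (Quotient.out (ConjClasses.mk g)))
    [CompactSpace ↥(Subgroup.centralizer ({g} : Set G))]
    [LocallyCompactSpace G'] [SecondCountableTopology G'] [T2Space G']
    [MeasurableSpace (G' ⧸ Subgroup.centralizer ({e g} : Set G'))] [BorelSpace (G' ⧸ Subgroup.centralizer ({e g} : Set G'))]
    [hC : IsClosed ((Subgroup.centralizer ({e g} : Set G') : Subgroup G') : Set G')]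
    (t' : Measure ↥(Subgroup.centralizer ({e g} : Set G'))) [t'.IsMulLeftInvariant] [IsFiniteMeasureOnCompacts t'] [t'.IsOpenPosMeasure] [t'.IsInvInvariant] [SFinite t']
    [(Measure.map e ν).IsMulRightInvariant] (ht' : t' Set.univ = 1) (F : G' → ℂ) (hF : Continuous F) :
    classOrbitalIntegral m (fun x => F (e x)) (ConjClasses.mk g) =
      orbitalIntegral (e g) F (quotientMeasure (Subgroup.centralizer ({e g} : Set G')) t' hC (ν.map e)) := by
  haveI : CompactSpace ↥(Subgroup.centralizer ({e g} : Set G')) := compactSpace_centralizer_frame e g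
  rw [classOrbitalIntegral_comp_frame_eq_integral_conj_map e hm g hc F hF,
    orbitalIntegral_quotientMeasure_eq_integral_conj_of_measure_univ_eq_one (e g) t' (ν.map e) ht' F hF]

end Canonical

/-! ## §C The dock in the socket's letters (`HeckeFLAtFrame`, D ED. 5 :901–:951), generic `N` -/

section Socket

variable (L : Type) [Field L] [NumberField L] [IsCMField L] {N : ℕ} (H : Matrix (Fin N) (Fin N) L)
  (v : HeightOneSpectrum (𝓞 ↥(maximalRealSubfield L))) (w : PlacesOver L v) (hw : IsCMField.complexConj L • w.1 = w.1)
  [MeasurableSpace ((cmDatum L N H).Local v)] [BorelSpace ((cmDatum L N H).Local v)]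
  [∀ γ : (cmDatum L N H).Local v, MeasurableSpace (((cmDatum L N H).Local v) ⧸ Subgroup.centralizer ({γ} : Set ((cmDatum L N H).Local v)))]
  [∀ γ : (cmDatum L N H).Local v, BorelSpace (((cmDatum L N H).Local v) ⧸ Subgroup.centralizer ({γ} : Set ((cmDatum L N H).Local v)))]
  [MeasurableSpace ↥(unitaryGroupOfForm (galAdicCompletionMap (L := L) (IsCMField.complexConj L) hw) ((StdForm.antidiagonal N).over (w.1.adicCompletion L)))]
  [BorelSpace ↥(unitaryGroupOfForm (galAdicCompletionMap (L := L) (IsCMField.complexConj L) hw) ((StdForm.antidiagonal N).over (w.1.adicCompletion L)))]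
  (νG : Measure ((cmDatum L N H).Local v)) [νG.IsHaarMeasure] [νG.IsMulRightInvariant]
  {mG : OrbitalMeasureFamily ((cmDatum L N H).Local v)}
  (hmG : mG.IsCanonical (fun γ => IsRegularElt (γ.val : GL (Fin N) (LocalRing L v))) νG)
  (eG : (cmDatum L N H).Local v ≃ₜ*
    ↥(unitaryGroupOfForm (galAdicCompletionMap (L := L) (IsCMField.complexConj L) hw) ((StdForm.antidiagonal N).over (w.1.adicCompletion L))))
  (φ : heckeAlgebra ℂ
    ↥(unitaryGroupOfForm (galAdicCompletionMap (L := L) (IsCMField.complexConj L) hw) ((StdForm.antidiagonal N).over (w.1.adicCompletion L)))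
    (unitaryInt (galAdicCompletionMap (L := L) (IsCMField.complexConj L) hw) ((StdForm.antidiagonal N).over (w.1.adicCompletion L))))

omit [∀ γ : (cmDatum L N H).Local v, MeasurableSpace (((cmDatum L N H).Local v) ⧸ Subgroup.centralizer ({γ} : Set ((cmDatum L N H).Local v)))]
  [∀ γ : (cmDatum L N H).Local v, BorelSpace (((cmDatum L N H).Local v) ⧸ Subgroup.centralizer ({γ} : Set ((cmDatum L N H).Local v)))]
  [νG.IsHaarMeasure] [νG.IsMulRightInvariant] in
/-- **(T.8) THE K-MASS THROUGH THE FRAME**: under the socket's K-law `eG g ∈ K₀ ↔ g ∈ cmLocalIntegralLevel` and its normalisation `νG(cmLocalIntegralLevel) = 1`,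
`(eG_* νG)(K₀) = 1` (`K₀ = U′ ∩ GL_N(𝒪_w)` is open ★ `isOpen_unitaryInt`, hence measurable; (T.3)) — the factor `ν(K₀)` of ★ A1 ∕ ★ G3 is `1`.
[cite: Rogawski1990, §4.9 pp. 54–55] [cite: DeitmarEchterhoff2014, Thm. 1.5.3] -/
theorem map_frame_unitaryInt_eq_one
    (hEK : ∀ g : (cmDatum L N H).Local v,
      eG g ∈ unitaryInt (galAdicCompletionMap (L := L) (IsCMField.complexConj L) hw) ((StdForm.antidiagonal N).over (w.1.adicCompletion L)) ↔
        g ∈ cmLocalIntegralLevel L N H v)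
    (hνG : νG (cmLocalIntegralLevel L N H v) = 1) :
    (νG.map eG) (unitaryInt (galAdicCompletionMap (L := L) (IsCMField.complexConj L) hw) ((StdForm.antidiagonal N).over (w.1.adicCompletion L))) = 1 := by
  rw [map_frame_apply_eq_of_memLaw eG νG hEK (isOpen_unitaryInt _ _).measurableSet, hνG]

include hmG in
/-- **(T.9) HEAD FOR (G5), PLAIN FORM — THE SOCKET'S CANONICAL CLASS ORBITAL INTEGRAL OF `g ↦ (toVector K₀ φ).coeff (eG g · K₀)` AT AN ELLIPTIC CLASS IS A PLAIN
CONJUGATION INTEGRAL ON `U′`**: for `g ∈ G′_v` with COMPACT centraliser and `IsRegularElt` at the representative `out ⟦g⟧` (the letter `hmG` consumes verbatim),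
`classOrbitalIntegral mG (fun x => (toVector K₀ φ).coeff ↑(eG x)) ⟦g⟧ = ∫_{U′} (toVector K₀ φ).coeff ↑(u · eG g · u⁻¹) d(eG_* νG)(u)`
((T.5) with `F := u ↦ (toVector K₀ φ).coeff (u K₀)`, continuous because `K₀` is open, ★ `continuous_coeff_mk`).  The `Lines`-level `heckeToFun K₀ φ u` unfolds to this `coeff` by `rfl`.
[cite: Rogawski1990, §4.3 (4.3.1) p. 43; §4.9 pp. 54–56] [cite: DeitmarEchterhoff2014, Cor. 1.5.4] -/
theorem classOrbitalIntegral_coeff_toVector_frame_eq_integral_conj (g : (cmDatum L N H).Local v)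
    (hc : IsRegularElt (((Quotient.out (ConjClasses.mk g) : (cmDatum L N H).Local v)).val : GL (Fin N) (LocalRing L v)))
    [CompactSpace ↥(Subgroup.centralizer ({g} : Set ((cmDatum L N H).Local v)))] :
    classOrbitalIntegral mG
        (fun x => (toVector (unitaryInt (galAdicCompletionMap (L := L) (IsCMField.complexConj L) hw) ((StdForm.antidiagonal N).over (w.1.adicCompletion L))) φ).coeff
          ((eG x : ↥(unitaryGroupOfForm (galAdicCompletionMap (L := L) (IsCMField.complexConj L) hw) ((StdForm.antidiagonal N).over (w.1.adicCompletion L)))) :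
            ↥(unitaryGroupOfForm (galAdicCompletionMap (L := L) (IsCMField.complexConj L) hw) ((StdForm.antidiagonal N).over (w.1.adicCompletion L))) ⧸
              unitaryInt (galAdicCompletionMap (L := L) (IsCMField.complexConj L) hw) ((StdForm.antidiagonal N).over (w.1.adicCompletion L))))
        (ConjClasses.mk g) =
      ∫ u, (toVector (unitaryInt (galAdicCompletionMap (L := L) (IsCMField.complexConj L) hw) ((StdForm.antidiagonal N).over (w.1.adicCompletion L))) φ).coeff
          ((u * eG g * u⁻¹ : ↥(unitaryGroupOfForm (galAdicCompletionMap (L := L) (IsCMField.complexConj L) hw) ((StdForm.antidiagonal N).over (w.1.adicCompletion L)))) :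
            ↥(unitaryGroupOfForm (galAdicCompletionMap (L := L) (IsCMField.complexConj L) hw) ((StdForm.antidiagonal N).over (w.1.adicCompletion L))) ⧸
              unitaryInt (galAdicCompletionMap (L := L) (IsCMField.complexConj L) hw) ((StdForm.antidiagonal N).over (w.1.adicCompletion L)))
        ∂(νG.map eG) :=
  classOrbitalIntegral_comp_frame_eq_integral_conj_map eG hmG g hc _ (continuous_coeff_mk _ (isOpen_unitaryInt _ _) _)

include hmG in
/-- **(T.9′) the same with the regularity letter at `g` itself** (`IsRegularElt` is conjugation-invariant, ★ `isRegularElt_of_isConj`; `out ⟦g⟧ ∼ g`).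
[cite: Rogawski1990, §4.3 (4.3.1) p. 43; §4.9 pp. 54–56] -/
theorem classOrbitalIntegral_coeff_toVector_frame_eq_integral_conj_of_isRegularElt (g : (cmDatum L N H).Local v)
    (hreg : IsRegularElt ((g.val : GL (Fin N) (LocalRing L v))))
    [CompactSpace ↥(Subgroup.centralizer ({g} : Set ((cmDatum L N H).Local v)))] :
    classOrbitalIntegral mG
        (fun x => (toVector (unitaryInt (galAdicCompletionMap (L := L) (IsCMField.complexConj L) hw) ((StdForm.antidiagonal N).over (w.1.adicCompletion L))) φ).coeff
          ((eG x : ↥(unitaryGroupOfForm (galAdicCompletionMap (L := L) (IsCMField.complexConj L) hw) ((StdForm.antidiagonal N).over (w.1.adicCompletion L)))) :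
            ↥(unitaryGroupOfForm (galAdicCompletionMap (L := L) (IsCMField.complexConj L) hw) ((StdForm.antidiagonal N).over (w.1.adicCompletion L))) ⧸
              unitaryInt (galAdicCompletionMap (L := L) (IsCMField.complexConj L) hw) ((StdForm.antidiagonal N).over (w.1.adicCompletion L))))
        (ConjClasses.mk g) =
      ∫ u, (toVector (unitaryInt (galAdicCompletionMap (L := L) (IsCMField.complexConj L) hw) ((StdForm.antidiagonal N).over (w.1.adicCompletion L))) φ).coeff
          ((u * eG g * u⁻¹ : ↥(unitaryGroupOfForm (galAdicCompletionMap (L := L) (IsCMField.complexConj L) hw) ((StdForm.antidiagonal N).over (w.1.adicCompletion L)))) :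
            ↥(unitaryGroupOfForm (galAdicCompletionMap (L := L) (IsCMField.complexConj L) hw) ((StdForm.antidiagonal N).over (w.1.adicCompletion L))) ⧸
              unitaryInt (galAdicCompletionMap (L := L) (IsCMField.complexConj L) hw) ((StdForm.antidiagonal N).over (w.1.adicCompletion L)))
        ∂(νG.map eG) := by
  have hconj : IsConj g (Quotient.out (ConjClasses.mk g)) := ConjClasses.mk_eq_mk_iff_isConj.1 (Quotient.out_eq (ConjClasses.mk g)).symm
  exact classOrbitalIntegral_coeff_toVector_frame_eq_integral_conj L H v w hw νG hmG eG φ g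
    (isRegularElt_of_isConj ((Subgroup.subtype _).map_isConj hconj) hreg)

include hmG in
/-- **(T.10) HEAD FOR (G1) ∕ (E1), IN ★ A1's CURRENCY — THE SOCKET'S CANONICAL CLASS ORBITAL INTEGRAL IS THE QUOTIENT-MEASURE ORBITAL INTEGRAL ON `U′` AGAINST `eG_* νG`**:
with ★ A1's instance letters on `U′`, on the coset space of `Z({eG g})`, and on a mass-one `t′` on the compact `Z({eG g})` (binders byte for byte as ★ A1 :237–:252),
`classOrbitalIntegral mG (fun x => (toVector K₀ φ).coeff ↑(eG x)) ⟦g⟧ = orbitalIntegral (eG g) (fun u => (toVector K₀ φ).coeff ↑u) (quotientMeasure Z({eG g}) t′ hC (eG_* νG))`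
— the right-hand side is the left-hand side of ★ A1 `orbitalIntegral_doubleCosetShell_eq_mul_ncard_displaced` ∕ ★ G3 ∕ ★ G3-NUMBERS at `N = 3`, `γ := eG g`, `ν := eG_* νG`
(Haar: Mathlib instance; right-invariance of `eG_* νG` is the binder `[(Measure.map eG νG).IsMulRightInvariant]`, discharged by `haveI := isMulRightInvariant_map_frame eG νG`), and of
their H-side twins at `N = 2`; with (T.8) their factor `(ν K₀).toReal` is `1`.
[cite: Rogawski1990, §4.3 (4.3.1) p. 43; §4.9 pp. 54–56] [cite: Kottwitz1986BaseChangeUnits, §1 pp. 240–242] [cite: DeitmarEchterhoff2014, Thm. 1.5.3] -/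
theorem classOrbitalIntegral_coeff_toVector_frame_eq_orbitalIntegral (g : (cmDatum L N H).Local v)
    (hc : IsRegularElt (((Quotient.out (ConjClasses.mk g) : (cmDatum L N H).Local v)).val : GL (Fin N) (LocalRing L v)))
    [CompactSpace ↥(Subgroup.centralizer ({g} : Set ((cmDatum L N H).Local v)))]
    [LocallyCompactSpace ↥(unitaryGroupOfForm (galAdicCompletionMap (L := L) (IsCMField.complexConj L) hw) ((StdForm.antidiagonal N).over (w.1.adicCompletion L)))]
    [SecondCountableTopology ↥(unitaryGroupOfForm (galAdicCompletionMap (L := L) (IsCMField.complexConj L) hw) ((StdForm.antidiagonal N).over (w.1.adicCompletion L)))]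
    [T2Space ↥(unitaryGroupOfForm (galAdicCompletionMap (L := L) (IsCMField.complexConj L) hw) ((StdForm.antidiagonal N).over (w.1.adicCompletion L)))]
    [MeasurableSpace (↥(unitaryGroupOfForm (galAdicCompletionMap (L := L) (IsCMField.complexConj L) hw) ((StdForm.antidiagonal N).over (w.1.adicCompletion L))) ⧸
      Subgroup.centralizer ({eG g} : Set ↥(unitaryGroupOfForm (galAdicCompletionMap (L := L) (IsCMField.complexConj L) hw) ((StdForm.antidiagonal N).over (w.1.adicCompletion L)))))]
    [BorelSpace (↥(unitaryGroupOfForm (galAdicCompletionMap (L := L) (IsCMField.complexConj L) hw) ((StdForm.antidiagonal N).over (w.1.adicCompletion L))) ⧸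
      Subgroup.centralizer ({eG g} : Set ↥(unitaryGroupOfForm (galAdicCompletionMap (L := L) (IsCMField.complexConj L) hw) ((StdForm.antidiagonal N).over (w.1.adicCompletion L)))))]
    [hC : IsClosed ((Subgroup.centralizer ({eG g} : Set ↥(unitaryGroupOfForm (galAdicCompletionMap (L := L) (IsCMField.complexConj L) hw) ((StdForm.antidiagonal N).over (w.1.adicCompletion L)))) :
      Subgroup ↥(unitaryGroupOfForm (galAdicCompletionMap (L := L) (IsCMField.complexConj L) hw) ((StdForm.antidiagonal N).over (w.1.adicCompletion L)))) :
        Set ↥(unitaryGroupOfForm (galAdicCompletionMap (L := L) (IsCMField.complexConj L) hw) ((StdForm.antidiagonal N).over (w.1.adicCompletion L))))]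
    (t' : Measure ↥(Subgroup.centralizer ({eG g} : Set ↥(unitaryGroupOfForm (galAdicCompletionMap (L := L) (IsCMField.complexConj L) hw) ((StdForm.antidiagonal N).over (w.1.adicCompletion L))))))
    [t'.IsMulLeftInvariant] [IsFiniteMeasureOnCompacts t'] [t'.IsOpenPosMeasure] [t'.IsInvInvariant] [SFinite t']
    [(Measure.map eG νG).IsMulRightInvariant] (ht' : t' Set.univ = 1) :
    classOrbitalIntegral mG
        (fun x => (toVector (unitaryInt (galAdicCompletionMap (L := L) (IsCMField.complexConj L) hw) ((StdForm.antidiagonal N).over (w.1.adicCompletion L))) φ).coeff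
          ((eG x : ↥(unitaryGroupOfForm (galAdicCompletionMap (L := L) (IsCMField.complexConj L) hw) ((StdForm.antidiagonal N).over (w.1.adicCompletion L)))) :
            ↥(unitaryGroupOfForm (galAdicCompletionMap (L := L) (IsCMField.complexConj L) hw) ((StdForm.antidiagonal N).over (w.1.adicCompletion L))) ⧸
              unitaryInt (galAdicCompletionMap (L := L) (IsCMField.complexConj L) hw) ((StdForm.antidiagonal N).over (w.1.adicCompletion L))))
        (ConjClasses.mk g) =
      orbitalIntegral (eG g)
        (fun u : ↥(unitaryGroupOfForm (galAdicCompletionMap (L := L) (IsCMField.complexConj L) hw) ((StdForm.antidiagonal N).over (w.1.adicCompletion L))) =>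
          (toVector (unitaryInt (galAdicCompletionMap (L := L) (IsCMField.complexConj L) hw) ((StdForm.antidiagonal N).over (w.1.adicCompletion L))) φ).coeff
            (u : ↥(unitaryGroupOfForm (galAdicCompletionMap (L := L) (IsCMField.complexConj L) hw) ((StdForm.antidiagonal N).over (w.1.adicCompletion L))) ⧸
              unitaryInt (galAdicCompletionMap (L := L) (IsCMField.complexConj L) hw) ((StdForm.antidiagonal N).over (w.1.adicCompletion L))))
        (quotientMeasure
          (Subgroup.centralizer ({eG g} : Set ↥(unitaryGroupOfForm (galAdicCompletionMap (L := L) (IsCMField.complexConj L) hw) ((StdForm.antidiagonal N).over (w.1.adicCompletion L)))))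
          t' hC (νG.map eG)) :=
  classOrbitalIntegral_comp_frame_eq_orbitalIntegral_map eG hmG g hc t' ht' _ (continuous_coeff_mk _ (isOpen_unitaryInt _ _) _)

end Socket

end Summit.HodgeConjecture.HodgeConjecture.R90.S6

end
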